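import Summits.BirchSwinnertonDyer.BirchSwinnertonDyer.Theorems.GenusKolyvaginAtTwoTorsionCellGenusDepth
import HarnessLib

/-!
# LINE 49 «full_vertex» — the GENUS TRACE OF A HALF (dictionary lemma of the pen's Theorem D, memo #6 §5.7, F10)

Crux R″ `RankOneTwoTorsionResidualAtTwo` (stmt-BirchSwinnertonDyer-27478) of route GenusKolyvaginAtTwo, LINE 49
«torsion_cell_full_vertex_bsdidea1» (pen bsd-idea-1).  This file hosts, as kernel-checked SUPPORT algebra for the line's
research stubs F0aJ′ / F0bJ (their `C₁`-halves are fed by the lower bound (LOW)_k of memo #6, whose step (2) is THEOREM D: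
«the genus-trace component functional kills the depth-`≤ 1` lattice `Λ̃_{≤1}` and the Heegner genus trace, and fires on the
depth-`2` class»), the pen's HOME-only brick `line49/engine/GenusTrace.lean` r2 (sha16 eb420bff5ad2291f; W-79: the pen may
not propose) in DEF-FREE form, and GENERALISES it:

* §1 `sum_klein_eq_zero`, `sum_addMonoidHom_klein` — a homomorphism out of the Klein four-group sums to zero (brick);
  **`sum_eq_zero_of_mul_of_sq_eq_one`** (new) — for ANY finite group `G` of exponent `2` with `4 ∣ |G|` and any map
  `e : G → A` with `e (σ * τ) = e σ + e τ`, `∑ σ, e σ = 0` (the Kummer-cocycle sum of a half; proof by pairing `σ ↔ τσ`,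
  `exists_card_eq_two_mul_and_sum_eq`).
* §2 `sum_act_eq_card_smul_add_sum`, `trace_of_half`, `sum_units_smul_eq_zero`, `sum_one_smul_eq_card_smul` (brick: trace
  of a point with known cocycle; of a half over a group of order `4`; the trace kills non-trivially twisted generators).
* §3 `mem_of_functional_eq_zero`, `mem_iff_functional_eq_zero`, **`theoremD_skeleton`** (brick: the SEPARATION step — an
  additive functional killing `L` and `y_G` but not `W̃`, with `Λ̃ = L ∪ (W̃ + L)`, forces `y_G ∈ L`).
* §4 character counts: `card_filter_val_eq_neg_one_of_eq_one` (brick), **`two_mul_card_filter_val_eq_neg_one`** (new, any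
  finite `G`: a non-trivial `ℤˣ`-character takes the value `−1` on exactly half of `G`), `card_filter_val_eq_neg_one` (brick,
  `|G| = 4`), `card_filter_val_eq_neg_one_of_card_eq_two_pow` (`|G| = 2^k`).
* §5 **`trace_half_eq_pow`** (new, `|G| = 2^k`, `k ≥ 2`) and **`trace_half_eq`** (brick, `|G| = 4`) — THE DICTIONARY LEMMA:
  generators `g d` twisted by characters `χ d` (`χ D = 1`, `χ d ≠ 1` for `d ≠ D`), `R` a half of `∑_{d∈v} g d + t`
  (`2 • t = 0`) with `σR = R − ∑_{d∈v, χ_d(σ)=−1} g d + e σ` and `∑_σ e σ = 0` ⟹ `Tr_G R = [D ∈ v] • 2^(k−1) • g D`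
  (memo: `Tr_G R_v = 2[D∈v] z′`, so the genus-trace functional kills `Λ̃_{≤1}`).
* The sequel `…GenusTracePoints` proves the same for a `DistribMulAction` with the cocycle-sum hypothesis DISCHARGED
  (the Kummer cocycle of a half is `2`-torsion-valued, hence fixed, hence a homomorphism, hence sums to zero by §1) and reads
  it on `E(L)` under the tree's Galois action for a curve with full rational `2`-torsion.

Dictionary (memo #6 §5.7): `G = Gal(K_gen/K) ≅ (ℤ/2)^k`, `A = E₀(K_gen)`, `g d = g′_d` (odd-twist generators, `χ_d`-eigen),
`g D = z′` (`χ_D = 1` on `G`), `t = t_v ∈ E₀[2]`, `R = R_v = ½(∑_{d∈v} g′_d + t_v)`, `e` its Kummer cocycle with values in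
`E₀(K_gen)[2] = E₀[2] ⊆ E₀(ℚ)`.  Pure algebra: no elliptic curve, Selmer group, Néron model or Heegner point occurs here;
the instantiation `S0 = φ ∘ comp_𝔭 ∘ Tr` and its Heegner-safety (GZ III (3.1)) are the pen's PAPER steps and are NOT
claimed.  Everything is proved (no `sorry`, standard axioms); nothing here is a statement of the line, and NOTHING HERE
PROVES R″ or any summit — BSD is not advanced by this file alone.

## References

* [Serre1977] J.-P. Serre, *Linear Representations of Finite Groups*, GTM 42 (1977), §2.3 (orthogonality of characters).
* [SilvermanAEC2009] J. H. Silverman, *The Arithmetic of Elliptic Curves*, 2nd ed. (2009), VIII.§2 (the Kummer pairing /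
  cocycle of a half), X.1 (complete `2`-descent).
* [GrossZagier1986] B. Gross, D. Zagier, *Heegner points and derivatives of `L`-series*, Invent. Math. 84 (1986), III §3
  (Prop. 3.1) — the arithmetic input of Theorem D, cited for context only.
-/

namespace Summit.BirchSwinnertonDyer.BirchSwinnertonDyer.Theorems.GenusKolyvaginAtTwo.FullVertex.GenusTrace

open BigOperators Finset

/-! ## §1 Cocycle sums: Klein four-group, and any exponent-`2` group of order divisible by `4` -/

section Klein

/-- The elements of the Klein four-group `ZMod 2 × ZMod 2` sum to zero. [cite: Serre1977, §2.3] -/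
theorem sum_klein_eq_zero : (∑ g : ZMod 2 × ZMod 2, g) = 0 := by decide

/-- A homomorphism out of the Klein four-group sums to zero over the group
(`Σ_{σ ∈ V₄} e(σ) = 0` for the Kummer cocycle `e_v : Gal(K_gen/K) → E₀[2]`). (Brick, verbatim.) [cite: Serre1977, §2.3] -/
theorem sum_addMonoidHom_klein {A : Type*} [AddCommGroup A] (e : ZMod 2 × ZMod 2 →+ A) :
    (∑ g : ZMod 2 × ZMod 2, e g) = 0 := by
  rw [← map_sum, sum_klein_eq_zero, map_zero]

end Klein

section CocycleSum

variable {G : Type*} [Group G] {A : Type*} [AddCommGroup A]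

/-- A multiplicative-to-additive homomorphism kills `1`. [cite: Serre1977, §2.3] -/
theorem apply_one_eq_zero_of_mul (e : G → A) (he : ∀ σ τ, e (σ * τ) = e σ + e τ) : e 1 = 0 := by
  have h := he 1 1
  rw [one_mul] at h
  have h' : e 1 + e 1 = e 1 + 0 := by rw [add_zero]; exact h.symm
  exact add_left_cancel h'

/-- On a group of exponent `2` a multiplicative-to-additive homomorphism takes `2`-torsion values.
[cite: SilvermanAEC2009, VIII.§2] -/
theorem two_nsmul_apply_eq_zero_of_mul (e : G → A) (he : ∀ σ τ, e (σ * τ) = e σ + e τ)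
    (h2 : ∀ σ : G, σ * σ = 1) (σ : G) : (2 : ℕ) • e σ = 0 := by
  rw [two_nsmul, ← he, h2, apply_one_eq_zero_of_mul e he]

/-- **Pairing `σ ↔ τσ`.**  Let `τ ≠ 1`, `τ² = 1`, `e (τσ) = e τ + e σ` and `2 • e σ = 0` for all `σ`.  Then every finite set
`s ⊆ G` stable under `σ ↦ τσ` has even size `2m` and `∑_{σ∈s} e σ = m • e τ`. [cite: Serre1977, §2.3] -/
theorem exists_card_eq_two_mul_and_sum_eq [DecidableEq G] (e : G → A) (τ : G) (hτ : τ ≠ 1) (hττ : τ * τ = 1)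
    (hpair : ∀ σ, e (τ * σ) = e τ + e σ) (he2 : ∀ σ, (2 : ℕ) • e σ = 0) (s : Finset G)
    (hs : ∀ σ ∈ s, τ * σ ∈ s) : ∃ m : ℕ, s.card = 2 * m ∧ ∑ σ ∈ s, e σ = m • e τ := by
  induction s using Finset.strongInduction with
  | H s ih =>
    rcases s.eq_empty_or_nonempty with rfl | ⟨σ, hσ⟩
    · exact ⟨0, rfl, by simp⟩
    · have hτσ : τ * σ ∈ s := hs σ hσ
      have hne : τ * σ ≠ σ := fun h => hτ (mul_right_cancel (h.trans (one_mul σ).symm))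
      have hmem : τ * σ ∈ s.erase σ := Finset.mem_erase.mpr ⟨hne, hτσ⟩
      have hsub : (s.erase σ).erase (τ * σ) ⊂ s :=
        (Finset.erase_subset _ _).trans_ssubset (Finset.erase_ssubset hσ)
      have hstab : ∀ ρ ∈ (s.erase σ).erase (τ * σ), τ * ρ ∈ (s.erase σ).erase (τ * σ) := by
        intro ρ hρ
        simp only [Finset.mem_erase] at hρ ⊢
        obtain ⟨hρ1, hρ2, hρ3⟩ := hρ
        refine ⟨fun h => hρ2 (mul_left_cancel h), fun h => hρ1 ?_, hs ρ hρ3⟩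
        rw [← h, ← mul_assoc, hττ, one_mul]
      obtain ⟨m, hcard, hsum⟩ := ih _ hsub hstab
      refine ⟨m + 1, ?_, ?_⟩
      · have h1 : (s.erase σ).card + 1 = s.card := Finset.card_erase_add_one hσ
        have h2 : ((s.erase σ).erase (τ * σ)).card + 1 = (s.erase σ).card := Finset.card_erase_add_one hmem
        omega
      · have h2σ : e σ + e σ = 0 := by rw [← two_nsmul]; exact he2 σ
        rw [← Finset.add_sum_erase s e hσ, ← Finset.add_sum_erase (s.erase σ) e hmem, hsum, hpair σ, add_nsmul,
          one_nsmul]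
        calc e σ + (e τ + e σ + m • e τ) = (e σ + e σ) + (m • e τ + e τ) := by abel
          _ = m • e τ + e τ := by rw [h2σ, zero_add]

/-- **The cocycle sum vanishes.**  For a finite group `G` of exponent `2` with `4 ∣ |G|` and any `e : G → A` with
`e (σ * τ) = e σ + e τ`: `∑ σ, e σ = 0`.  (For `G = Gal(K_gen/K) ≅ (ℤ/2)^k`, `k ≥ 2`, this is the vanishing of the sum of the
Kummer cocycle of a half with rational `2`-torsion values, the hypothesis `∑_σ e_v(σ) = 0` of the dictionary lemma.)
[cite: Serre1977, §2.3] -/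
theorem sum_eq_zero_of_mul_of_sq_eq_one [Fintype G] [DecidableEq G] (e : G → A)
    (he : ∀ σ τ, e (σ * τ) = e σ + e τ) (h2 : ∀ σ : G, σ * σ = 1) (h4 : 4 ∣ Fintype.card G) :
    ∑ σ, e σ = 0 := by
  have hcard : 1 < Fintype.card G := lt_of_lt_of_le (by norm_num) (Nat.le_of_dvd Fintype.card_pos h4)
  obtain ⟨τ, hτ⟩ := Fintype.exists_ne_of_one_lt_card hcard (1 : G)
  have he2 : ∀ σ, (2 : ℕ) • e σ = 0 := two_nsmul_apply_eq_zero_of_mul e he h2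
  obtain ⟨m, hm, hsum⟩ := exists_card_eq_two_mul_and_sum_eq e τ hτ (h2 τ) (fun σ => he τ σ) he2 Finset.univ
    (fun σ _ => Finset.mem_univ _)
  rw [Finset.card_univ] at hm
  obtain ⟨m', rfl⟩ : 2 ∣ m := by
    have h4' : 4 ∣ 2 * m := hm ▸ h4
    omega
  rw [hsum, show (2 * m') • e τ = m' • ((2 : ℕ) • e τ) by rw [smul_smul, mul_comm], he2, smul_zero]

end CocycleSum

/-! ## §2 Traces of points with known cocycle (brick) -/

section Traces

/-- Trace of a point with known cocycle: if `act σ R = R + c σ` for every `σ`, then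
`Σ_σ act σ R = |G| • R + Σ_σ c σ`. (Brick, verbatim.) [cite: SilvermanAEC2009, VIII.§2] -/
theorem sum_act_eq_card_smul_add_sum {G A : Type*} [Fintype G] [AddCommGroup A]
    (act : G → A → A) (R : A) (c : G → A) (hact : ∀ σ, act σ R = R + c σ) :
    (∑ σ, act σ R) = Fintype.card G • R + ∑ σ, c σ := by
  simp_rw [hact, Finset.sum_add_distrib, Finset.sum_const, Finset.card_univ]

/-- Trace of a HALF over a group of order `4`: if `2 • R = P` and `act σ R = R + c σ`, then
`Σ_σ act σ R = 2 • P + Σ_σ c σ` (memo #6 §5.7, `Tr_G R_v = 2 P_v-part + Σ e_v`). (Brick, verbatim.)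
[cite: SilvermanAEC2009, VIII.§2] -/
theorem trace_of_half {G A : Type*} [Fintype G] [AddCommGroup A]
    (act : G → A → A) (R P : A) (c : G → A) (hG : Fintype.card G = 4) (h2 : (2 : ℕ) • R = P)
    (hact : ∀ σ, act σ R = R + c σ) :
    (∑ σ, act σ R) = (2 : ℕ) • P + ∑ σ, c σ := by
  rw [sum_act_eq_card_smul_add_sum act R c hact, hG, ← h2, smul_smul]
  norm_num

/-- The trace kills a non-trivially twisted generator: `Σ_σ χ(σ) • g = 0` for `χ ≠ 1` (`Tr_G g′_d = 0` for `d ≠ D`); the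
character sum itself is `…GenusDepth.sum_char_eq_zero`. (Brick.) [cite: Serre1977, §2.3] -/
theorem sum_units_smul_eq_zero {G A : Type*} [Group G] [Fintype G] [AddCommGroup A]
    (χ : G →* ℤˣ) (hχ : χ ≠ 1) (g : A) :
    (∑ σ, ((χ σ : ℤˣ) : ℤ) • g) = 0 := by
  rw [← Finset.sum_smul, GenusDepth.sum_char_eq_zero χ hχ, zero_smul]

/-- The trivial character contributes `|G| • g` (`Tr_G z′ = 4 z′` at `k = 2`). (Brick.) [cite: Serre1977, §2.3] -/
theorem sum_one_smul_eq_card_smul {G A : Type*} [Fintype G] [AddCommGroup A] (g : A) :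
    (∑ _σ : G, (1 : ℤ) • g) = (Fintype.card G : ℤ) • g := by
  simp [Finset.sum_const, Finset.card_univ]

end Traces

/-! ## §3 Separation by an additive functional: the logical core of Theorem D (brick) -/

section Separation

variable {A B : Type*} [AddCommGroup A] [AddCommGroup B]

/-- SEPARATION: an additive functional that kills the subgroup `L`, does not kill `w`, where `L` together with its coset
`w + L` exhausts the group, detects membership in `L`: `f y = 0 → y ∈ L`. (Brick, verbatim.) [cite: Serre1977, §2.3] -/
theorem mem_of_functional_eq_zero (f : A →+ B) (L : AddSubgroup A) (w : A)
    (hL : ∀ x ∈ L, f x = 0) (hw : f w ≠ 0) (hcover : ∀ y : A, y ∈ L ∨ y - w ∈ L)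
    {y : A} (hy : f y = 0) : y ∈ L := by
  rcases hcover y with h | h
  · exact h
  · exfalso
    apply hw
    have h1 : f (y - w) = 0 := hL _ h
    rw [map_sub, hy, zero_sub, neg_eq_zero] at h1
    exact h1

/-- Conversely the functional then has kernel exactly `L`: `y ∈ L ↔ f y = 0`. (Brick, verbatim.) [cite: Serre1977, §2.3] -/
theorem mem_iff_functional_eq_zero (f : A →+ B) (L : AddSubgroup A) (w : A)
    (hL : ∀ x ∈ L, f x = 0) (hw : f w ≠ 0) (hcover : ∀ y : A, y ∈ L ∨ y - w ∈ L) (y : A) :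
    y ∈ L ↔ f y = 0 :=
  ⟨fun h => hL y h, fun h => mem_of_functional_eq_zero f L w hL hw hcover h⟩

/-- **THEOREM D, abstract form** (memo #6 §5.7): `S0` kills the Heegner genus trace `yG` (on paper: Gross–Zagier III
Prop. 3.1 + `4 ∣ h_K`), kills the depth-`≤ 1` lattice `L`, and is non-zero on the depth-`2` class `W` spanning the other
coset; hence `yG ∈ L`.  Only the logic is kernel-checked; the three arithmetic inputs are hypotheses. (Brick, verbatim.)
[cite: GrossZagier1986, III Prop. 3.1] -/
theorem theoremD_skeleton (S0 : A →+ B) (L : AddSubgroup A) (W yG : A)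
    (h_safe : S0 yG = 0) (h_kills : ∀ x ∈ L, S0 x = 0) (h_fires : S0 W ≠ 0)
    (h_index2 : ∀ y : A, y ∈ L ∨ y - W ∈ L) : yG ∈ L :=
  mem_of_functional_eq_zero S0 L W h_kills h_fires h_index2 h_safe

end Separation

/-! ## §4 How often a `ℤˣ`-character takes the value `−1` -/

section Counts

variable {G : Type*} [Group G] [Fintype G]

/-- For the trivial character no element has value `−1`. (Brick, verbatim.) [cite: Serre1977, §2.3] -/
theorem card_filter_val_eq_neg_one_of_eq_one (χ : G →* ℤˣ) (hχ : χ = 1) :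
    (Finset.univ.filter (fun σ => ((χ σ : ℤˣ) : ℤ) = -1)).card = 0 := by
  rw [Finset.card_eq_zero, Finset.filter_eq_empty_iff]
  intro σ _
  rw [hχ]
  norm_num

/-- **A non-trivial `ℤˣ`-character takes the value `−1` on exactly half of `G`** (any finite group): from
`∑ σ, χ σ = 0` (`…GenusDepth.sum_char_eq_zero`). [cite: Serre1977, §2.3] -/
theorem two_mul_card_filter_val_eq_neg_one (χ : G →* ℤˣ) (hχ : χ ≠ 1) :
    2 * (Finset.univ.filter (fun σ => ((χ σ : ℤˣ) : ℤ) = -1)).card = Fintype.card G := by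
  have hsum : (∑ σ, ((χ σ : ℤˣ) : ℤ)) = 0 := GenusDepth.sum_char_eq_zero χ hχ
  have hsplit : (∑ σ, ((χ σ : ℤˣ) : ℤ)) = ∑ σ, (if ((χ σ : ℤˣ) : ℤ) = -1 then (-1 : ℤ) else 1) := by
    refine Finset.sum_congr rfl fun σ _ => ?_
    rcases Int.units_eq_one_or (χ σ) with h | h
    · rw [h]; norm_num
    · rw [h]; norm_num
  rw [hsplit, Finset.sum_ite, Finset.sum_const, Finset.sum_const, nsmul_eq_mul, nsmul_eq_mul] at hsum
  have hcard := Finset.card_filter_add_card_filter_not (s := (Finset.univ : Finset G))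
    (fun σ => ((χ σ : ℤˣ) : ℤ) = -1)
  rw [Finset.card_univ] at hcard
  omega

/-- On a group of order `4`, a non-trivial `ℤˣ`-character takes the value `−1` exactly twice
(`#{σ ∈ Gal(K_gen/K) : χ_d(σ) = −1} = 2` for `d ≠ D` at `k = 2`). (Brick.) [cite: Serre1977, §2.3] -/
theorem card_filter_val_eq_neg_one (χ : G →* ℤˣ) (hχ : χ ≠ 1) (hG : Fintype.card G = 4) :
    (Finset.univ.filter (fun σ => ((χ σ : ℤˣ) : ℤ) = -1)).card = 2 := by
  have h := two_mul_card_filter_val_eq_neg_one χ hχ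
  omega

/-- On a group of order `2^k` (`k ≥ 1`), a non-trivial `ℤˣ`-character takes the value `−1` exactly `2^(k−1)` times.
[cite: Serre1977, §2.3] -/
theorem card_filter_val_eq_neg_one_of_card_eq_two_pow (χ : G →* ℤˣ) (hχ : χ ≠ 1) {k : ℕ}
    (hG : Fintype.card G = 2 ^ k) (hk : 1 ≤ k) :
    (Finset.univ.filter (fun σ => ((χ σ : ℤˣ) : ℤ) = -1)).card = 2 ^ (k - 1) := by
  have h := two_mul_card_filter_val_eq_neg_one χ hχ
  obtain ⟨j, rfl⟩ : ∃ j, k = j + 1 := ⟨k - 1, by omega⟩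
  rw [hG, pow_succ, mul_comm (2 ^ j) 2] at h
  rw [Nat.add_sub_cancel]
  omega

end Counts

/-! ## §5 The dictionary lemma: the genus trace of a half -/

section Dictionary

variable {ι G A : Type*} [Group G] [Fintype G] [AddCommGroup A] [DecidableEq ι]

/-- **DICTIONARY LEMMA, `|G| = 2^k` (`k ≥ 2`).**  `G` acts through `act`; the generators `g d` are `χ d`-twisted with
`χ D = 1` (the class of `z′`) and `χ d ≠ 1` for `d ≠ D`; `R` is a half of `∑_{d∈v} g d + t` (`t` `2`-torsion) with
`σR = R − ∑_{d ∈ v, χ_d(σ) = −1} g d + e σ` and cocycle sum `∑ e σ = 0`.  Then `Tr_G R = 2^(k−1) • g D` if `D ∈ v` and `0`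
otherwise (`Tr_G R_v = 2^(k−1) [D∈v] z′`; at `k = 2` this is the brick's `trace_half_eq`). [cite: Serre1977, §2.3]
[cite: SilvermanAEC2009, VIII.§2] -/
theorem trace_half_eq_pow {k : ℕ} (hG : Fintype.card G = 2 ^ k) (hk : 2 ≤ k) (χ : ι → G →* ℤˣ) (D : ι)
    (hχ : ∀ d, d ≠ D → χ d ≠ 1) (hD : χ D = 1)
    (g : ι → A) (v : Finset ι) (t : A) (ht : (2 : ℕ) • t = 0) (R : A)
    (hR : (2 : ℕ) • R = (∑ d ∈ v, g d) + t)
    (act : G → A → A) (e : G → A) (he : (∑ σ, e σ) = 0)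
    (hact : ∀ σ, act σ R = R - (∑ d ∈ v.filter (fun d => ((χ d σ : ℤˣ) : ℤ) = -1), g d) + e σ) :
    (∑ σ, act σ R) = if D ∈ v then (2 ^ (k - 1) : ℕ) • g D else 0 := by
  -- step 1: expand the trace
  have h1 : (∑ σ, act σ R)
      = Fintype.card G • R - (∑ σ, ∑ d ∈ v.filter (fun d => ((χ d σ : ℤˣ) : ℤ) = -1), g d) + ∑ σ, e σ := by
    simp_rw [hact, Finset.sum_add_distrib, Finset.sum_sub_distrib, Finset.sum_const, Finset.card_univ]
  -- step 2: swap the double sum and count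
  have h2 : (∑ σ, ∑ d ∈ v.filter (fun d => ((χ d σ : ℤˣ) : ℤ) = -1), g d)
      = ∑ d ∈ v, (Finset.univ.filter (fun σ => ((χ d σ : ℤˣ) : ℤ) = -1)).card • g d := by
    simp_rw [Finset.sum_filter]
    rw [Finset.sum_comm]
    refine Finset.sum_congr rfl fun d _ => ?_
    rw [← Finset.sum_filter, Finset.sum_const]
  have h3 : ∀ d ∈ v, (Finset.univ.filter (fun σ => ((χ d σ : ℤˣ) : ℤ) = -1)).card • g d
      = if d = D then 0 else (2 ^ (k - 1) : ℕ) • g d := by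
    intro d _
    by_cases hd : d = D
    · subst hd; rw [card_filter_val_eq_neg_one_of_eq_one _ hD]; simp
    · rw [card_filter_val_eq_neg_one_of_card_eq_two_pow _ (hχ d hd) hG (by omega), if_neg hd]
  -- step 3: `|G| • R = 2^(k-1) • (2 • R)` and `2^(k-1) • t = 0`
  have h4 : Fintype.card G • R = ∑ d ∈ v, (2 ^ (k - 1) : ℕ) • g d := by
    have hpow : 2 ^ k = 2 ^ (k - 1) * 2 := by
      obtain ⟨j, rfl⟩ : ∃ j, k = j + 1 := ⟨k - 1, by omega⟩
      rw [Nat.add_sub_cancel, pow_succ]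
    have hpow' : 2 ^ (k - 1) = 2 ^ (k - 2) * 2 := by
      obtain ⟨j, rfl⟩ : ∃ j, k = j + 2 := ⟨k - 2, by omega⟩
      rw [Nat.add_sub_cancel, show j + 2 - 1 = j + 1 by omega, pow_succ]
    rw [hG, hpow, mul_smul, hR, smul_add, Finset.smul_sum, hpow', mul_smul, ht, smul_zero, add_zero]
  rw [h1, h2, Finset.sum_congr rfl h3, he, add_zero, h4]
  -- now: Σ_{d∈v} 2^(k-1)•g d − Σ_{d∈v} (if d = D then 0 else 2^(k-1)•g d) = if D ∈ v then 2^(k-1)•g D else 0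
  rw [sub_eq_iff_eq_add]
  by_cases hDv : D ∈ v
  · rw [if_pos hDv]
    rw [← Finset.add_sum_erase v _ hDv, ← Finset.add_sum_erase v _ hDv, if_pos rfl, zero_add]
    congr 1
    refine Finset.sum_congr rfl fun d hd => ?_
    rw [if_neg (Finset.ne_of_mem_erase hd)]
  · rw [if_neg hDv, zero_add]
    refine Finset.sum_congr rfl fun d hd => ?_
    rw [if_neg (fun h : d = D => hDv (h ▸ hd))]

/-- **DICTIONARY LEMMA of Theorem D** (memo #6 §5.7), `|G| = 4`: the genus trace of a HALF.  `G` of order `4` acts through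
`act`; the generators `g d` are `χ d`-twisted with `χ D = 1` (the class of `z′`) and `χ d ≠ 1` for `d ≠ D`; `R` is a half
of `∑_{d∈v} g d + t` (`t` `2`-torsion) with `σR = R − ∑_{d ∈ v, χ_d(σ) = −1} g d + e σ` and cocycle sum `∑ e σ = 0`.  Then
`Tr_G R = 2 • g D` if `D ∈ v` and `0` otherwise (`Tr_G R_v = 2[D∈v] z′`). (Brick statement, now a case of `trace_half_eq_pow`.)
[cite: Serre1977, §2.3] [cite: SilvermanAEC2009, VIII.§2] -/
theorem trace_half_eq (hG : Fintype.card G = 4) (χ : ι → G →* ℤˣ) (D : ι)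
    (hχ : ∀ d, d ≠ D → χ d ≠ 1) (hD : χ D = 1)
    (g : ι → A) (v : Finset ι) (t : A) (ht : (2 : ℕ) • t = 0) (R : A)
    (hR : (2 : ℕ) • R = (∑ d ∈ v, g d) + t)
    (act : G → A → A) (e : G → A) (he : (∑ σ, e σ) = 0)
    (hact : ∀ σ, act σ R = R - (∑ d ∈ v.filter (fun d => ((χ d σ : ℤˣ) : ℤ) = -1), g d) + e σ) :
    (∑ σ, act σ R) = if D ∈ v then (2 : ℕ) • g D else 0 := by
  have h := trace_half_eq_pow (k := 2) (by rw [hG]; norm_num) le_rfl χ D hχ hD g v t ht R hR act e he hact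
  have h2 : (2 ^ (2 - 1) : ℕ) = 2 := by norm_num
  rw [h, h2]

end Dictionary

end Summit.BirchSwinnertonDyer.BirchSwinnertonDyer.Theorems.GenusKolyvaginAtTwo.FullVertex.GenusTrace
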